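import Literature.MathematicalPhysics.QuantumFieldTheory.Balaban1983to89.B15Claim189LambdaPin

/-!
# NODE 00 — THE COLLAR RADIUS OF def-T's INDEX MAP: every point of the new large-field region `Z_{k+1}(t) = Λ_{k+1}(t)ᶜ` of the label `t = (P,Q,R,S)_{k+1}`
# lies within 24 layers of `𝐃_{k+1}`-cubes of the OLD large-field region `Z_k` or of a LABEL CUBE of `t` (a χ_{k+1}-cube of `P_{k+1} ∪ Q_{k+1} ∪ R_{k+1}`)

Seat `pub-ymgap-dag-n20-d` (R134 (a) N20 NE7b s3), gen 38; `--kind proof --supports stmt-QuantumFields-27366 --as helper`; COUNT-NEUTRAL; THEOREMS ONLY.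
[III] = [Balaban1988Convergent].  Companion of `Node00.StepWeightsOfRecord` (n02-b ∕ def-T: `hullD`, `fillD`, `Zreg`, `Ztilde4`, `Bdom`, `Omega0`, `guardΩ`, `OmegaOfLabel`,
`Lambda0`, `LambdaOfLabel`, `σOfRecord` — (3.2) ∕ (3.5) ∕ (3.20) of [III] with the typing guards), `B14SeparationOfRecord` (dag-n11-e: the torus collar lemma `mem_cubeEnl_of_meet`,
`mem_hullD_iff`, `mem_fillD_iff`) and `B15Claim189CubePin` ∕ `B15Claim189LambdaPin` (dag-n12-e: `cubeOfSite`, `subset_hullD`, `hullD_mono_layers`).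

WHY (the N20 lineage's LOCATED-4, cell bus 2026-08-30).  A «fresh exit» of a cube from the small-field region (`c ⊆ Λ_k`, `c ⊆ Λ_{k+1}ᶜ`) is charged a small factor in print ONLY
when it is caused by a NEW large-field cube of the label ([LF-II] (1.79) p. 383); the (3.5) ∕ (3.20) collars evict the neighbourhood of `Z_k` for free.  This file proves the
deterministic half of the dichotomy: OUTSIDE a fixed collar of `Z_k`, every point of `Z_{k+1}(t)` is within a fixed number of `𝐃_{k+1}`-layers of a cube of `P ∪ Q ∪ R`.  The layer
counts are generous (two extra layers per composition of hulls, one per typing guard `fillD`, from the alignment-free torus collar lemma); print's own figure is smaller.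

WHAT IS HERE.  §1 layer algebra over an `s`-cube family of the fine torus (generic `P`): (private `hullD_mono_set`), `hullD_union`, `hullD_hullD_subset` (`hullD n (hullD m X) ⊆ hullD (n+m+2) X`),
`compl_fillD_subset_hullD_compl` (`(fillD X)ᶜ ⊆ hullD 0 Xᶜ`, `0 < s`: a point outside the filling shares a grid cube with a point outside `X`); §2 the regions of the index map:
`compl_LamPrev_eq_Zreg`, `Ztilde4_subset_hullD_Zreg`, `compl_Bdom_subset`, `compl_Omega0_subset`, `compl_guardΩ_subset`, `compl_OmegaOfLabel_subset`, `compl_Lambda0_subset`,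
★★ `compl_LambdaOfLabel_subset_hullD` (the collar radius: `Λ_{k+1}(t)ᶜ ⊆ hullD 24 Z_k ∪ hullD 18 ∪P ∪ hullD 13 ∪Q ∪ hullD 5 ∪R`), ★★ `compl_Λ_succ_σOfRecord_subset_hullD` (σ-form, one hull:
`⊆ hullD 24 (Z_k ∪ ∪P ∪ ∪Q ∪ ∪R)`), ★ `compl_Λ_succ_σOfRecord_diff_subset` (outside the 24-collar of `Z_k`: within 24 layers of a label cube).

HONEST SCOPE.  [bookkeeping] finite torus geometry over def-T's definitions BY NAME; nothing of Bałaban's asserted; no estimate; counts UNMOVED (typed 28∕28 · discharged 8∕27);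
one finite four-torus programme at fixed `ε` — nothing continuum ∕ ℝ⁴ ∕ OS ∕ mass gap ∕ Clay.  No `def`, no `sorry`, no `axiom`, no `instance`, no `notation`.
-/

noncomputable section

namespace Literature.MathematicalPhysics.QuantumFieldTheory.Balaban1983to89.Node00

open T4Continuum B14.Eq218Concrete B14DomainGeom B15Eq112TorusCover
open B14SeparationOfRecord (mem_cubeEnl_of_meet mem_hullD_iff mem_fillD_iff)
open B15Claim189CubePin (cubeOfSite cubeOfSite_mem_cubeIndices mem_cubeEnl_cubeOfSite)
open B15Claim189LambdaPin (subset_hullD hullD_mono_layers)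

/-! ## §1  Layer algebra over an `s`-cube family of the fine torus -/

section LayerAlgebra

variable {P : Params} {s : ℕ}

/-- `hullD` is monotone in the region (private twin of dag-n11's Summits-side `hullD_mono_set`, which a Literature file cannot import). [folklore] -/
private theorem hullD_mono_set (n : ℕ) {X Y : Set (Site P 0)} (h : X ⊆ Y) : hullD P s n X ⊆ hullD P s n Y := by
  intro x hx
  obtain ⟨a, ha, ⟨z, hza, hzX⟩, hxa⟩ := mem_hullD_iff.1 hx
  exact mem_hullD_iff.2 ⟨a, ha, ⟨z, hza, h hzX⟩, hxa⟩

/-- `hullD` of a union is the union of the hulls (a collar meets `X ∪ Y` iff it meets `X` or `Y`). [cite: Balaban1988Convergent, p.264–265 (bookkeeping)] -/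
theorem hullD_union (n : ℕ) (X Y : Set (Site P 0)) : hullD P s n (X ∪ Y) = hullD P s n X ∪ hullD P s n Y := by
  ext x
  constructor
  · intro hx
    obtain ⟨a, ha, ⟨z, hza, hzXY⟩, hxa⟩ := mem_hullD_iff.1 hx
    rcases hzXY with hzX | hzY
    · exact Or.inl (mem_hullD_iff.2 ⟨a, ha, ⟨z, hza, hzX⟩, hxa⟩)
    · exact Or.inr (mem_hullD_iff.2 ⟨a, ha, ⟨z, hza, hzY⟩, hxa⟩)
  · rintro (hx | hx)
    · exact hullD_mono_set n Set.subset_union_left hx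
    · exact hullD_mono_set n Set.subset_union_right hx

/-- **COMPOSITION OF HULLS**: `hullD n (hullD m X) ⊆ hullD (n + m + 2) X` — two applications of the torus collar lemma (one extra layer each for the missing grid alignment).
[cite: Balaban1988Convergent, p.264–265 (bookkeeping)] -/
theorem hullD_hullD_subset (n m : ℕ) (X : Set (Site P 0)) : hullD P s n (hullD P s m X) ⊆ hullD P s (n + m + 2) X := by
  intro x hx
  obtain ⟨a, ha, ⟨y, hya, hyH⟩, hxa⟩ := mem_hullD_iff.1 hx
  obtain ⟨b, -, ⟨z, hzb, hzX⟩, hyb⟩ := mem_hullD_iff.1 hyH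
  -- `x` (in the cube `a`, whose `n`-collar meets the cube `b` at `y`) lies within `n + 1` layers of `b`
  have hxb : x ∈ cubeEnl P s b (n + 0 + 1) := mem_cubeEnl_of_meet (a := a) (b := b) (n := n) (m := 0) hya hyb hxa
  -- hence the `m`-collar of `b` (containing `z ∈ X`) lies within `(n + 1) + m + 1` layers of `a`
  have hza : z ∈ cubeEnl P s a (n + 0 + 1 + m + 1) := mem_cubeEnl_of_meet (a := b) (b := a) (n := n + 0 + 1) (m := m) hxb hxa hzb
  exact hullD_mono_layers (by omega) X (mem_hullD_iff.2 ⟨a, ha, ⟨z, hza, hzX⟩, hxa⟩)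

/-- **THE TYPING GUARD COSTS NO LAYER BEYOND THE CUBE**: a point outside the filling `fillD s X` shares its grid cube with a point outside `X`, so `(fillD s X)ᶜ ⊆ hullD 0 Xᶜ`
(`0 < s`: the grid cubes cover the torus). [cite: Balaban1988Convergent, (2.1) p.254 (bookkeeping)] -/
theorem compl_fillD_subset_hullD_compl (hs : 0 < s) (X : Set (Site P 0)) : (fillD P s X)ᶜ ⊆ hullD P s 0 Xᶜ := by
  intro x hx
  have hxa := mem_cubeEnl_cubeOfSite (P := P) s hs x
  have ha := cubeOfSite_mem_cubeIndices (P := P) s hs x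
  have hnot : ¬ cubeEnl P s (cubeOfSite s x) 0 ⊆ X := fun hsub => hx (mem_fillD_iff.2 ⟨_, ha, hsub, hxa⟩)
  obtain ⟨x₁, hx₁a, hx₁X⟩ := Set.not_subset.1 hnot
  exact mem_hullD_iff.2 ⟨_, ha, ⟨x₁, hx₁a, hx₁X⟩, hxa⟩

/-- Bookkeeping form used below: `hullD n (hullD m X ∪ Y) ⊆ hullD (n + m + 2) X ∪ hullD n Y`. [cite: Balaban1988Convergent, p.264–265 (bookkeeping)] -/
theorem hullD_hullD_union_subset (n m : ℕ) (X Y : Set (Site P 0)) :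
    hullD P s n (hullD P s m X ∪ Y) ⊆ hullD P s (n + m + 2) X ∪ hullD P s n Y := by
  rw [hullD_union]
  exact Set.union_subset_union (hullD_hullD_subset n m X) le_rfl

end LayerAlgebra

/-! ## §2  The regions of the index map: complements within bounded layers of `Z_k` and of the label cubes -/

section IndexMap

variable (F : T4Family) (ν : Stage7Numerics) (M : ℕ) (p : B12.RunParams) (g : ℕ → ℝ) (k : ℕ)

/-- `(LamPrev s)ᶜ = Zreg s` (`= Λ_kᶜ` for `k ≥ 1`, `= ∅` at `k = 0`). [cite: Balaban1988Convergent, (2.3) p.255 (bookkeeping)] -/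
theorem compl_LamPrev_eq_Zreg (s : SeqOfRecord F ν M g p.K k) : (LamPrev F ν M p g k s)ᶜ = Zreg F ν M p g k s := by
  unfold LamPrev Zreg
  split_ifs <;> simp

variable {F ν M p g k}

/-- `Z̃_k^{∼4} ⊆ hullD 6 Z_k`. [cite: Balaban1988Convergent, p.264–265 (bookkeeping)] -/
theorem Ztilde4_subset_hullD_Zreg (s : SeqOfRecord F ν M g p.K k) :
    Ztilde4 F ν M p g k s ⊆ hullD (F.P p.K) (sideD F ν M p g k) 6 (Zreg F ν M p g k s) :=
  (hullD_hullD_subset 4 0 _).trans (hullD_mono_layers (by norm_num) _)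

/-- `(B^{k+1}(P¹))ᶜ ⊆ hullD 3 (∪P) ∪ hullD 9 Z_k`. [cite: Balaban1988Convergent, p.265 (bookkeeping)] -/
theorem compl_Bdom_subset (s : SeqOfRecord F ν M g p.K k) (Pl : Finset (Iχ F ν p g k)) :
    (Bdom F ν M p g k s Pl)ᶜ ⊆ hullD (F.P p.K) (sideD F ν M p g k) 3 (cubesχ F ν p g k Pl) ∪ hullD (F.P p.K) (sideD F ν M p g k) 9 (Zreg F ν M p g k s) := by
  unfold Bdom
  rw [compl_compl]
  refine (hullD_hullD_union_subset 1 0 _ _).trans (Set.union_subset_union (hullD_mono_layers (by norm_num) _) ?_)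
  exact (hullD_mono_set 1 (Ztilde4_subset_hullD_Zreg s)).trans ((hullD_hullD_subset 1 6 _).trans (hullD_mono_layers (by norm_num) _))

/-- `Ω₀(P,Q)ᶜ ⊆ hullD 4 (∪Q) ∪ hullD 9 (∪P) ∪ hullD 15 Z_k` ((3.5)). [cite: Balaban1988Convergent, (3.5) p.265 (bookkeeping)] -/
theorem compl_Omega0_subset (s : SeqOfRecord F ν M g p.K k) (Pl Ql : Finset (Iχ F ν p g k)) :
    (Omega0 F ν M p g k s Pl Ql)ᶜ ⊆ hullD (F.P p.K) (sideD F ν M p g k) 4 (cubesχ F ν p g k Ql) ∪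
      (hullD (F.P p.K) (sideD F ν M p g k) 9 (cubesχ F ν p g k Pl) ∪ hullD (F.P p.K) (sideD F ν M p g k) 15 (Zreg F ν M p g k s)) := by
  unfold Omega0
  rw [compl_compl]
  refine (hullD_hullD_union_subset 2 0 _ _).trans (Set.union_subset_union (hullD_mono_layers (by norm_num) _) ?_)
  refine ((hullD_hullD_subset 2 0 _).trans (hullD_mono_layers (show 2 + 0 + 2 ≤ 4 by norm_num) _)).trans ?_
  refine (hullD_mono_set 4 (compl_Bdom_subset s Pl)).trans ?_
  rw [hullD_union]
  exact Set.union_subset_union ((hullD_hullD_subset 4 3 _).trans (hullD_mono_layers (by norm_num) _))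
    ((hullD_hullD_subset 4 9 _).trans (hullD_mono_layers (by norm_num) _))

/-- `guardΩᶜ ⊆ hullD 0 (∪P) ∪ hullD 6 Z_k` (`0 < sideD`). [cite: Balaban1988Convergent, (3.5) p.265 (bookkeeping)] -/
theorem compl_guardΩ_subset (hsD : 0 < sideD F ν M p g k) (s : SeqOfRecord F ν M g p.K k) (Pl : Finset (Iχ F ν p g k)) :
    (guardΩ F ν M p g k s Pl)ᶜ ⊆ hullD (F.P p.K) (sideD F ν M p g k) 0 (cubesχ F ν p g k Pl) ∪ hullD (F.P p.K) (sideD F ν M p g k) 6 (Zreg F ν M p g k s) := by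
  unfold guardΩ W32
  rw [Set.compl_inter, Set.compl_inter, compl_LamPrev_eq_Zreg]
  simp only [compl_compl]
  rintro x ((hx | hx) | hx)
  · exact Or.inr (hullD_mono_layers (by norm_num) _ (subset_hullD hsD 0 _ hx))
  · exact Or.inr (Ztilde4_subset_hullD_Zreg s hx)
  · exact Or.inl (subset_hullD hsD 0 _ hx)

/-- `Ω_{k+1}(t)ᶜ ⊆ hullD 6 (∪Q) ∪ hullD 11 (∪P) ∪ hullD 17 Z_k` (`0 < sideD`). [cite: Balaban1988Convergent, (3.5) p.265 (bookkeeping)] -/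
theorem compl_OmegaOfLabel_subset (hsD : 0 < sideD F ν M p g k) (s : SeqOfRecord F ν M g p.K k) (t : LbOfRecord F ν p g k) :
    (OmegaOfLabel F ν M p g k s t)ᶜ ⊆ hullD (F.P p.K) (sideD F ν M p g k) 6 (cubesχ F ν p g k t.2.1) ∪
      (hullD (F.P p.K) (sideD F ν M p g k) 11 (cubesχ F ν p g k t.1) ∪ hullD (F.P p.K) (sideD F ν M p g k) 17 (Zreg F ν M p g k s)) := by
  unfold OmegaOfLabel
  refine (compl_fillD_subset_hullD_compl hsD _).trans ?_
  rw [Set.compl_inter]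
  refine (hullD_mono_set 0 (Set.union_subset_union (compl_Omega0_subset s t.1 t.2.1) (compl_guardΩ_subset hsD s t.1))).trans ?_
  intro x hx
  simp only [hullD_union, Set.mem_union] at hx
  rcases hx with (hx | hx | hx) | hx | hx
  · exact Or.inl (hullD_mono_layers (by norm_num) _ (hullD_hullD_subset 0 4 _ hx))
  · exact Or.inr (Or.inl (hullD_mono_layers (by norm_num) _ (hullD_hullD_subset 0 9 _ hx)))
  · exact Or.inr (Or.inr (hullD_mono_layers (by norm_num) _ (hullD_hullD_subset 0 15 _ hx)))
  · exact Or.inr (Or.inl (hullD_mono_layers (by norm_num) _ (hullD_hullD_subset 0 0 _ hx)))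
  · exact Or.inr (Or.inr (hullD_mono_layers (by norm_num) _ (hullD_hullD_subset 0 6 _ hx)))

/-- `Λ₀(t)ᶜ ⊆ hullD 3 (∪R) ∪ hullD 11 (∪Q) ∪ hullD 16 (∪P) ∪ hullD 22 Z_k` ((3.20); `0 < sideD`). [cite: Balaban1988Convergent, (3.20) p.269 (bookkeeping)] -/
theorem compl_Lambda0_subset (hsD : 0 < sideD F ν M p g k) (s : SeqOfRecord F ν M g p.K k) (t : LbOfRecord F ν p g k) :
    (Lambda0 F ν M p g k s t)ᶜ ⊆ hullD (F.P p.K) (sideD F ν M p g k) 3 (cubesχ F ν p g k t.2.2.1) ∪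
      (hullD (F.P p.K) (sideD F ν M p g k) 11 (cubesχ F ν p g k t.2.1) ∪
        (hullD (F.P p.K) (sideD F ν M p g k) 16 (cubesχ F ν p g k t.1) ∪ hullD (F.P p.K) (sideD F ν M p g k) 22 (Zreg F ν M p g k s))) := by
  unfold Lambda0
  rw [compl_compl, hullD_union]
  rintro x (hx | hx)
  · have hx' := hullD_hullD_subset 1 0 _ hx
    have hx'' := hullD_mono_set (1 + 0 + 2) (compl_OmegaOfLabel_subset hsD s t) hx'
    simp only [hullD_union, Set.mem_union] at hx''
    rcases hx'' with hx | hx | hx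
    · exact Or.inr (Or.inl (hullD_mono_layers (by norm_num) _ (hullD_hullD_subset (1 + 0 + 2) 6 _ hx)))
    · exact Or.inr (Or.inr (Or.inl (hullD_mono_layers (by norm_num) _ (hullD_hullD_subset (1 + 0 + 2) 11 _ hx))))
    · exact Or.inr (Or.inr (Or.inr (hullD_mono_layers (by norm_num) _ (hullD_hullD_subset (1 + 0 + 2) 17 _ hx))))
  · exact Or.inl (hullD_mono_layers (by norm_num) _ (hullD_hullD_subset 1 0 _ hx))

/-- ★★ **THE COLLAR RADIUS OF THE INDEX MAP**: `Λ_{k+1}(t)ᶜ ⊆ hullD 5 (∪R) ∪ hullD 13 (∪Q) ∪ hullD 18 (∪P) ∪ hullD 24 Z_k` — every point of the new large-field region lies within 24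
layers of `𝐃_{k+1}`-cubes of the old large-field region `Z_k = Λ_kᶜ` (`∅` at `k = 0`) or within 18 layers of a label cube of `t` (`0 < sideD`, i.e. `0 < M`, `1 ≤ R_{k+1}`, `1 ≤ L`).
[cite: Balaban1988Convergent, (3.5) p.265, (3.20) p.269 (bookkeeping)] -/
theorem compl_LambdaOfLabel_subset_hullD (hsD : 0 < sideD F ν M p g k) (s : SeqOfRecord F ν M g p.K k) (t : LbOfRecord F ν p g k) :
    (LambdaOfLabel F ν M p g k s t)ᶜ ⊆ hullD (F.P p.K) (sideD F ν M p g k) 5 (cubesχ F ν p g k t.2.2.1) ∪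
      (hullD (F.P p.K) (sideD F ν M p g k) 13 (cubesχ F ν p g k t.2.1) ∪
        (hullD (F.P p.K) (sideD F ν M p g k) 18 (cubesχ F ν p g k t.1) ∪ hullD (F.P p.K) (sideD F ν M p g k) 24 (Zreg F ν M p g k s))) := by
  unfold LambdaOfLabel
  refine (compl_fillD_subset_hullD_compl hsD _).trans ?_
  rw [Set.compl_inter]
  refine (hullD_mono_set 0 (Set.union_subset_union (compl_Lambda0_subset hsD s t) (compl_OmegaOfLabel_subset hsD s t))).trans ?_
  intro x hx
  simp only [hullD_union, Set.mem_union] at hx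
  rcases hx with (hx | hx | hx | hx) | hx | hx | hx
  · exact Or.inl (hullD_mono_layers (by norm_num) _ (hullD_hullD_subset 0 3 _ hx))
  · exact Or.inr (Or.inl (hullD_mono_layers (by norm_num) _ (hullD_hullD_subset 0 11 _ hx)))
  · exact Or.inr (Or.inr (Or.inl (hullD_mono_layers (by norm_num) _ (hullD_hullD_subset 0 16 _ hx))))
  · exact Or.inr (Or.inr (Or.inr (hullD_mono_layers (by norm_num) _ (hullD_hullD_subset 0 22 _ hx))))
  · exact Or.inr (Or.inl (hullD_mono_layers (by norm_num) _ (hullD_hullD_subset 0 6 _ hx)))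
  · exact Or.inr (Or.inr (Or.inl (hullD_mono_layers (by norm_num) _ (hullD_hullD_subset 0 11 _ hx))))
  · exact Or.inr (Or.inr (Or.inr (hullD_mono_layers (by norm_num) _ (hullD_hullD_subset 0 17 _ hx))))

/-- ★★ **σ-FORM, ONE HULL**: `((σOfRecord s t).Λ (k+1))ᶜ ⊆ hullD 24 (Z_k ∪ ∪P ∪ ∪Q ∪ ∪R)`. [cite: Balaban1988Convergent, (3.5) p.265, (3.20) p.269 (bookkeeping)] -/
theorem compl_Λ_succ_σOfRecord_subset_hullD (hsD : 0 < sideD F ν M p g k) (s : SeqOfRecord F ν M g p.K k) (t : LbOfRecord F ν p g k) :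
    ((σOfRecord F ν M p g k s t).Λ (k + 1))ᶜ ⊆ hullD (F.P p.K) (sideD F ν M p g k) 24
      (Zreg F ν M p g k s ∪ (cubesχ F ν p g k t.1 ∪ (cubesχ F ν p g k t.2.1 ∪ cubesχ F ν p g k t.2.2.1))) := by
  rw [σOfRecord_Λ_succ]
  refine (compl_LambdaOfLabel_subset_hullD hsD s t).trans ?_
  rintro x (hx | hx | hx | hx)
  · exact hullD_mono_layers (by norm_num) _ (hullD_mono_set 5 (fun y hy => Or.inr (Or.inr (Or.inr hy))) hx)
  · exact hullD_mono_layers (by norm_num) _ (hullD_mono_set 13 (fun y hy => Or.inr (Or.inr (Or.inl hy))) hx)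
  · exact hullD_mono_layers (by norm_num) _ (hullD_mono_set 18 (fun y hy => Or.inr (Or.inl hy)) hx)
  · exact hullD_mono_set 24 (fun y hy => Or.inl hy) hx

/-- ★ **OUTSIDE THE COLLAR OF THE OLD REGION, THE NEW LARGE-FIELD REGION IS NEAR A LABEL CUBE**: `((σ s t).Λ (k+1))ᶜ ∖ hullD 24 Z_k ⊆ hullD 24 (∪P ∪ ∪Q ∪ ∪R)` — a «fresh
exit» farther than 24 `𝐃_{k+1}`-layers from `Z_k` is within 24 layers of a NEW large-field cube of the label (the event [LF-II] (1.79) p. 383 charges).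
[cite: Balaban1988Convergent, (3.5) p.265, (3.20) p.269 (bookkeeping)] -/
theorem compl_Λ_succ_σOfRecord_diff_subset (hsD : 0 < sideD F ν M p g k) (s : SeqOfRecord F ν M g p.K k) (t : LbOfRecord F ν p g k) :
    ((σOfRecord F ν M p g k s t).Λ (k + 1))ᶜ \ hullD (F.P p.K) (sideD F ν M p g k) 24 (Zreg F ν M p g k s) ⊆
      hullD (F.P p.K) (sideD F ν M p g k) 24 (cubesχ F ν p g k t.1 ∪ (cubesχ F ν p g k t.2.1 ∪ cubesχ F ν p g k t.2.2.1)) := by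
  rintro x ⟨hx, hxZ⟩
  have h := compl_Λ_succ_σOfRecord_subset_hullD hsD s t hx
  rw [hullD_union] at h
  exact h.resolve_left hxZ

end IndexMap

end Literature.MathematicalPhysics.QuantumFieldTheory.Balaban1983to89.Node00

end
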